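import Summits.BirchSwinnertonDyer.Rank1Residual.ManinAdditive.CuspidalKummerClass
import Literature.NumberTheory.EllipticCurves.ModularParamFormalDictionaryProofs
import HarnessLib

/-!
# The short germ versus the minimal germ: `z = θ(z_W)`, and `Θ_T·z_W³ = (c·z)³·Θ^{min}(z_W)`
# (route `ManinLocalTwoThree`, crux C3 `ManinPrimeToThreeAtNine` stmt-BirchSwinnertonDyer-22968; cell bsd-f2-manin, prover seat p3 gen 15 —
# transport half of node (AN1) «`h^{min} = ρ⁻¹h ∈ ℤ⟦q⟧`» of -an's UDC line, MEMO-an §80.12 step (5): `Θ_T = ρ³·Θ^{min}`, `ρ = c·t_s/z_W`)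

-an's tangent-line Kummer series `Θ_T = kummerCubeSeries W c X₀ Y₀ z` lives on the SHORT model `E_{W,c} = vc • W`,
`vc = (u, r, s, t) = (c⁻¹, −b₂/12, −a₁/2, a₁b₂/24 − a₃/2)`, read through the short germ `z` (`log_{E_{W,c}}(z) = Σ aₙqⁿ/n`).
The integral model `W` has its own germ `z_W := exp_W(c·Σ aₙqⁿ/n)` (Honda: `z_W ∈ ℤ⟦q⟧`, tree `exists_int_coeff_formalExp_subst_lSeriesLog`).
This file is the dictionary between the two, as identities of formal power series over `ℚ` (no analysis, no integrality):

* `smul_eq_shortModel` — `vc • W = shortModel W c`;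
* `shortGerm_eq_formalVariableChange_subst` — **`z = θ_vc(z_W)`** (`θ_vc = formalVariableChange`, the tree's isomorphism of formal
  groups; both sides have `log_{E_{W,c}} = Σ aₙqⁿ/n`, by `formalLog_subst_formalVariableChange_subst`);
* `shortGerm_mul_eq` — the cleared form of `θ`: `c·z·(X_W − (a₁/2)z_W X_W − (a₃/2)z_W³) = z_W X_W + (b₂/12) z_W³` (`X_W = z_W²·x`);
* `formalXMulSq_shortGerm_mul_sq` — **`x_s = c²(x + b₂/12)`** cleared: `X_s(z)·z_W² = c²z²·(X_W + (b₂/12)z_W²)`;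
* **`kummerCubeSeries_mul_cube_eq`** — for ANY `x₁ y₁ l₁ ∈ ℚ`, with `X₁ = c²(x₁ + b₂/12)`, `Y₁ = c³(y₁ + (a₁x₁ + a₃)/2)` and slope
  `α₁ = c(l₁ + a₁/2)`: `[Y_s(z) − Y₁z³ − α₁(X_s(z)z − X₁z³)]·z_W³ = (cz)³·[Y_W(z_W) − y₁z_W³ − l₁(X_W(z_W)z_W − x₁z_W³)]`, i.e.
  `z³(f^{short}∘φ) · z_W³ = (cz)³ · z_W³(f^{W}∘φ)` for the line functions `f^{short} = y − Y₁ − α₁(x − X₁) = c³·f^{W}`;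
* `kummerCubeSeries_mul_cube_eq_of_isShortThreeTorsion` — the instance (AN1) uses: `(X₀, Y₀)` a `3`-torsion point of `E_{W,c}`,
  `α = tangentSlope`, `(x_T, y_T, λ) = (X₀/c² − b₂/12, Y₀/c³ − (a₁x_T + a₃)/2, α/c − a₁/2)`.

HONEST FRAMING.  Formal-group bookkeeping only (Silverman AEC III.1/IV.1 under a change of variables); nothing about (AN1), C3, Manin's
conjecture or BSD is proved here.
[cite: SilvermanAEC2009, III.1 (admissible changes of variables `x = u²x' + r`, `y = u³y' + su²x' + t`) and IV.1 (`z = −x/y`, `w = −1/y`, expansions of `x, y`)]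
[cite: SilvermanAEC2009, IV.5.5 (formal logarithm; `log ∘ θ = u·log`)]
-/

set_option autoImplicit false
-- lint-debt: the directory name repeats the summit name (sibling precedent `ManinLocalTwoThreeKummerCubeSigmaLeaves.lean`)
set_option linter.dupNamespace false

noncomputable section

open PowerSeries WeierstrassCurve Literature.NumberTheory.EllipticCurves
open Summit.BirchSwinnertonDyer.Rank1Residual.ManinAdditive.CuspidalKummer
open Summit.BirchSwinnertonDyer.Rank1Residual.ManinAdditive.CuspidalKummerThree

namespace Summit.BirchSwinnertonDyer.BirchSwinnertonDyer.Theorems.ManinLocalTwoThree.ShortGermTransport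

/-! ## §1 The change of variables `W → E_{W,c}` -/

section VC

variable (W : WeierstrassCurve ℚ) {c : ℤ} (vc : VariableChange ℚ)

/-- `u⁻¹ = c`. [folklore] -/
theorem val_u_inv_eq (hu : (vc.u : ℚ) = (c : ℚ)⁻¹) : ((vc.u⁻¹ : ℚˣ) : ℚ) = c := by
  rw [Units.val_inv_eq_inv_val, hu, inv_inv]

/-- **`vc • W = E_{W,c}`** for `vc = (c⁻¹, −b₂/12, −a₁/2, a₁b₂/24 − a₃/2)`: the transformed coefficients are
`(0, 0, 0, −c⁴c₄/48, −c⁶c₆/864)`. [cite: SilvermanAEC2009, III.1 (Table 3.1)] -/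
theorem smul_eq_shortModel (hu : (vc.u : ℚ) = (c : ℚ)⁻¹) (hr : vc.r = -(W.b₂ / 12)) (hs : vc.s = -(W.a₁ / 2))
    (ht : vc.t = W.a₁ * W.b₂ / 24 - W.a₃ / 2) : vc • W = shortModel W c := by
  have hui := val_u_inv_eq vc hu
  ext
  · rw [variableChange_a₁, hui, hs]; simp only [shortModel]; ring
  · rw [variableChange_a₂, hui, hs, hr]; simp only [shortModel, WeierstrassCurve.b₂]; ring
  · rw [variableChange_a₃, hui, hr, ht]; simp only [shortModel]; ring
  · rw [variableChange_a₄, hui, hs, hr, ht]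
    simp only [shortModel, WeierstrassCurve.c₄, WeierstrassCurve.b₂, WeierstrassCurve.b₄]; ring
  · rw [variableChange_a₆, hui, hr, ht]
    simp only [shortModel, WeierstrassCurve.c₆, WeierstrassCurve.b₂, WeierstrassCurve.b₄, WeierstrassCurve.b₆]; ring

/-- `t − s·r = −a₃/2`. [folklore] -/
theorem t_sub_s_mul_r (hr : vc.r = -(W.b₂ / 12)) (hs : vc.s = -(W.a₁ / 2)) (ht : vc.t = W.a₁ * W.b₂ / 24 - W.a₃ / 2) :
    vc.t - vc.s * vc.r = -(W.a₃ / 2) := by rw [ht, hs, hr]; ring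

end VC

/-! ## §2 `log ∘ exp`, and the short germ as `θ(z_W)` -/

/-- `log_W(exp_W(g)) = g` for `g ∈ Xℚ⟦X⟧`. [cite: SilvermanAEC2009, IV.5.5] -/
theorem formalLog_subst_formalExp_subst (W : WeierstrassCurve ℚ) {g : ℚ⟦X⟧} (hg : constantCoeff g = 0) :
    W.formalLog.subst (W.formalExp.subst g) = g := by
  have hgs : HasSubst g := HasSubst.of_constantCoeff_zero' hg
  have hes : HasSubst W.formalExp := HasSubst.of_constantCoeff_zero' W.constantCoeff_formalExp
  rw [← subst_comp_subst_apply hes hgs, W.formalLog_subst_formalExp, subst_X hgs]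

/-- `exp_W(log_W(g)) = g` for `g ∈ Xℚ⟦X⟧`. [cite: SilvermanAEC2009, IV.5.5] -/
theorem formalExp_subst_formalLog_subst (W : WeierstrassCurve ℚ) {g : ℚ⟦X⟧} (hg : constantCoeff g = 0) :
    W.formalExp.subst (W.formalLog.subst g) = g := by
  have hgs : HasSubst g := HasSubst.of_constantCoeff_zero' hg
  have hls : HasSubst W.formalLog := HasSubst.of_constantCoeff_zero' W.constantCoeff_formalLog
  rw [← subst_comp_subst_apply hls hgs, W.formalExp_subst_formalLog, subst_X hgs]

/-- `exp_W(g)(0) = 0`. [folklore] -/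
theorem constantCoeff_formalExp_subst (W : WeierstrassCurve ℚ) {g : ℚ⟦X⟧} (hg : constantCoeff g = 0) :
    constantCoeff (W.formalExp.subst g) = 0 := by
  rw [constantCoeff_subst_eq_constantCoeff hg, W.constantCoeff_formalExp]

/-- `(c • L)(0) = 0` for `L = Σ aₙqⁿ/n`. [folklore] -/
theorem constantCoeff_smul_lSeriesLog (c : ℚ) (a : ℕ → ℤ) : constantCoeff (c • lSeriesLog a) = 0 := by
  rw [smul_eq_C_mul, map_mul, ← coeff_zero_eq_constantCoeff_apply (lSeriesLog a), lSeriesLog, coeff_mk]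
  simp

section Germ

variable (W : WeierstrassCurve ℚ) {c : ℤ} (hc : c ≠ 0) (vc : VariableChange ℚ)
  (hu : (vc.u : ℚ) = (c : ℚ)⁻¹) (hr : vc.r = -(W.b₂ / 12)) (hs : vc.s = -(W.a₁ / 2)) (ht : vc.t = W.a₁ * W.b₂ / 24 - W.a₃ / 2)
  (a : ℕ → ℤ) {z : ℚ⟦X⟧} (hz : IsParamGerm W c a z)
include hc hu hr hs ht hz

/-- **The short germ is `θ_vc` of the minimal germ: `z = θ_vc(z_W)`, `z_W = exp_W(c·Σaₙqⁿ/n)`.**  Both sides lie in `Xℚ⟦X⟧` and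
have `log_{E_{W,c}}` equal to `Σ aₙqⁿ/n` (`log_{vc•W}(θ(t)) = u·log_W(t)`, `u = c⁻¹`). [cite: SilvermanAEC2009, IV.5.5 and III.1] -/
theorem shortGerm_eq_formalVariableChange_subst :
    z = (W.formalVariableChange vc).subst (W.formalExp.subst ((c : ℚ) • lSeriesLog a)) := by
  set L := lSeriesLog a with hL
  set zW := W.formalExp.subst ((c : ℚ) • L) with hzW
  have hc' : (c : ℚ) ≠ 0 := by exact_mod_cast hc
  have hcL0 : constantCoeff ((c : ℚ) • L) = 0 := constantCoeff_smul_lSeriesLog c a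
  have hzW0 : constantCoeff zW = 0 := constantCoeff_formalExp_subst W hcL0
  have hzWs : HasSubst zW := HasSubst.of_constantCoeff_zero' hzW0
  have hθ0 : constantCoeff ((W.formalVariableChange vc).subst zW) = 0 := by
    rw [constantCoeff_subst_eq_constantCoeff hzW0, constantCoeff_formalVariableChange]
  -- `log_s(θ(z_W)) = u · log_W(z_W) = c⁻¹ · (c L) = L`
  have hlogθ : (shortModel W c).formalLog.subst ((W.formalVariableChange vc).subst zW) = L := by
    rw [← smul_eq_shortModel W vc hu hr hs ht, W.formalLog_subst_formalVariableChange_subst vc hzW0, hzW,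
      formalLog_subst_formalExp_subst W hcL0, hu, smul_eq_C_mul, ← mul_assoc, ← map_mul, inv_mul_cancel₀ hc', map_one,
      one_mul]
  -- `log_s(z) = L`
  have hlogz : (shortModel W c).formalLog.subst z = L := hz.2
  -- apply `exp_s`
  rw [← formalExp_subst_formalLog_subst (shortModel W c) hz.1, hlogz, ← hlogθ,
    formalExp_subst_formalLog_subst (shortModel W c) hθ0]

/-- **`θ` cleared of denominators and of `w`: `c·z·(X_W − (a₁/2)·z_W·X_W − (a₃/2)·z_W³) = z_W·X_W + (b₂/12)·z_W³`**
(`X_W = formalXMulSq` read through `z_W`; from `θ·(1 + s z_W + (t − sr) w) = u·(z_W − r w)` and `X_W·w = z_W³`).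
[cite: SilvermanAEC2009, III.1 and IV.1] -/
theorem shortGerm_mul_eq :
    C (c : ℚ) * z * (W.formalXMulSq.subst (W.formalExp.subst ((c : ℚ) • lSeriesLog a))
        - C (W.a₁ / 2) * W.formalExp.subst ((c : ℚ) • lSeriesLog a)
            * W.formalXMulSq.subst (W.formalExp.subst ((c : ℚ) • lSeriesLog a))
        - C (W.a₃ / 2) * W.formalExp.subst ((c : ℚ) • lSeriesLog a) ^ 3) =
      W.formalExp.subst ((c : ℚ) • lSeriesLog a) * W.formalXMulSq.subst (W.formalExp.subst ((c : ℚ) • lSeriesLog a))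
        + C (W.b₂ / 12) * W.formalExp.subst ((c : ℚ) • lSeriesLog a) ^ 3 := by
  set L := lSeriesLog a with hL
  set zW := W.formalExp.subst ((c : ℚ) • L) with hzW
  have hc' : (c : ℚ) ≠ 0 := by exact_mod_cast hc
  have hcL0 : constantCoeff ((c : ℚ) • L) = 0 := constantCoeff_smul_lSeriesLog c a
  have hzW0 : constantCoeff zW = 0 := constantCoeff_formalExp_subst W hcL0
  have hzWs : HasSubst zW := HasSubst.of_constantCoeff_zero' hzW0
  have hθ := W.formalVariableChange_subst_mul_denom vc hzW0
  rw [← shortGerm_eq_formalVariableChange_subst W hc vc hu hr hs ht a hz, t_sub_s_mul_r W vc hr hs ht, hs, hr, hu] at hθ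
  -- `X_W · w = z_W³`
  have hXw : W.formalXMulSq.subst zW * W.formalW.subst zW = zW ^ 3 := by
    have h := congrArg (PowerSeries.subst zW) W.formalXMulSq_mul_formalW
    rwa [subst_mul hzWs, subst_pow hzWs, subst_X hzWs] at h
  have hcc : C (c : ℚ)⁻¹ * C (c : ℚ) = (1 : ℚ⟦X⟧) := by rw [← map_mul, inv_mul_cancel₀ hc', map_one]
  set Xw := W.formalXMulSq.subst zW with hXwdef
  set w := W.formalW.subst zW with hwdef
  simp only [map_neg] at hθ
  linear_combination (C (c : ℚ) * Xw) * hθ + (C (c : ℚ) * z * C (W.a₃ / 2) + C (W.b₂ / 12)) * hXw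
    + (zW * Xw + C (W.b₂ / 12) * Xw * w) * hcc

end Germ

/-! ## §3 `x_s = c²(x + b₂/12)` along the germs -/

/-- `Y = −X` (`z³y = −z²x`, as `y = −x/z`): `formalYMulCube = −formalXMulSq`, read through any `t ∈ Xℚ⟦X⟧`. [cite: SilvermanAEC2009, IV.1] -/
theorem formalYMulCube_subst_eq_neg (V : WeierstrassCurve ℚ) {t : ℚ⟦X⟧} (ht : constantCoeff t = 0) :
    V.formalYMulCube.subst t = -(V.formalXMulSq.subst t) := by
  have hts : HasSubst t := HasSubst.of_constantCoeff_zero' ht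
  rw [show V.formalYMulCube = -V.formalXMulSq from rfl, ← coe_substAlgHom hts, map_neg]

section Transport

variable (W : WeierstrassCurve ℚ) {c : ℤ} (hc : c ≠ 0) (vc : VariableChange ℚ)
  (hu : (vc.u : ℚ) = (c : ℚ)⁻¹) (hr : vc.r = -(W.b₂ / 12)) (hs : vc.s = -(W.a₁ / 2)) (ht : vc.t = W.a₁ * W.b₂ / 24 - W.a₃ / 2)
  (a : ℕ → ℤ) {z : ℚ⟦X⟧} (hz : IsParamGerm W c a z)
include hc hu hr hs ht hz

/-- **`x_s = c²·(x + b₂/12)` with poles cleared: `X_s(z)·z_W² = c²·z²·(X_W(z_W) + (b₂/12)·z_W²)`** (`X = z²x = formalXMulSq`;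
the tree's `formalXMulSq_variableChange_subst_mul_X_sq` read through `z_W`, with `z = θ(z_W)`). [cite: SilvermanAEC2009, III.1 and IV.1] -/
theorem formalXMulSq_shortGerm_mul_sq :
    (shortModel W c).formalXMulSq.subst z * W.formalExp.subst ((c : ℚ) • lSeriesLog a) ^ 2 =
      C (c : ℚ) ^ 2 * z ^ 2 * (W.formalXMulSq.subst (W.formalExp.subst ((c : ℚ) • lSeriesLog a))
        + C (W.b₂ / 12) * W.formalExp.subst ((c : ℚ) • lSeriesLog a) ^ 2) := by
  set L := lSeriesLog a with hL
  set zW := W.formalExp.subst ((c : ℚ) • L) with hzW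
  have hcL0 : constantCoeff ((c : ℚ) • L) = 0 := constantCoeff_smul_lSeriesLog c a
  have hzW0 : constantCoeff zW = 0 := constantCoeff_formalExp_subst W hcL0
  have hzWs : HasSubst zW := HasSubst.of_constantCoeff_zero' hzW0
  have hθs := W.hasSubst_formalVariableChange vc
  have h := congrArg (PowerSeries.subst zW) (W.formalXMulSq_variableChange_subst_mul_X_sq vc)
  simp only [subst_mul hzWs, subst_pow hzWs, subst_sub hzWs, subst_X hzWs, C_subst] at h
  rw [subst_comp_subst_apply hθs hzWs, ← shortGerm_eq_formalVariableChange_subst W hc vc hu hr hs ht a hz,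
    smul_eq_shortModel W vc hu hr hs ht, val_u_inv_eq vc hu, hr, map_neg] at h
  linear_combination h

/-! ## §4 `Θ_T · z_W³ = (c z)³ · Θ^{min}(z_W)` -/

/-- **The tangent-line Kummer series on the two models.**  For any `x₁ y₁ l₁ ∈ ℚ` put `X₁ = c²(x₁ + b₂/12)`,
`Y₁ = c³(y₁ + (a₁/2)x₁ + a₃/2)`, `α₁ = c(l₁ + a₁/2)` (the short-model images of the point `(x₁, y₁)` and of the slope `l₁`).  Then
`[Y_s(z) − Y₁z³ − α₁(X_s(z)z − X₁z³)] · z_W³ = (cz)³ · [Y_W(z_W) − y₁z_W³ − l₁(X_W(z_W)z_W − x₁z_W³)]`: the line function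
`y − Y₁ − α₁(x − X₁)` of `E_{W,c}` is `c³·(y − y₁ − l₁(x − x₁))` of `W`, and `z³ = (cz)³·z_W⁻³·(z_W³)`… read through the germs.
(`linear_combination` of §3 and the cleared `θ`.) [cite: SilvermanAEC2009, III.1 and IV.1] -/
theorem lineSeries_mul_cube_eq (x₁ y₁ l₁ : ℚ) :
    ((shortModel W c).formalYMulCube.subst z - C ((c : ℚ) ^ 3 * (y₁ + W.a₁ / 2 * x₁ + W.a₃ / 2)) * z ^ 3
        - C ((c : ℚ) * (l₁ + W.a₁ / 2)) * ((shortModel W c).formalXMulSq.subst z * z - C ((c : ℚ) ^ 2 * (x₁ + W.b₂ / 12)) * z ^ 3))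
        * W.formalExp.subst ((c : ℚ) • lSeriesLog a) ^ 3 =
      (C (c : ℚ) * z) ^ 3 *
        (W.formalYMulCube.subst (W.formalExp.subst ((c : ℚ) • lSeriesLog a))
          - C y₁ * W.formalExp.subst ((c : ℚ) • lSeriesLog a) ^ 3
          - C l₁ * (W.formalXMulSq.subst (W.formalExp.subst ((c : ℚ) • lSeriesLog a)) * W.formalExp.subst ((c : ℚ) • lSeriesLog a)
              - C x₁ * W.formalExp.subst ((c : ℚ) • lSeriesLog a) ^ 3)) := by
  set L := lSeriesLog a with hL
  set zW := W.formalExp.subst ((c : ℚ) • L) with hzW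
  have hcL0 : constantCoeff ((c : ℚ) • L) = 0 := constantCoeff_smul_lSeriesLog c a
  have hzW0 : constantCoeff zW = 0 := constantCoeff_formalExp_subst W hcL0
  have hI := formalXMulSq_shortGerm_mul_sq W hc vc hu hr hs ht a hz
  have hθ := shortGerm_mul_eq W hc vc hu hr hs ht a hz
  rw [← hL, ← hzW] at hI hθ
  rw [formalYMulCube_subst_eq_neg (shortModel W c) hz.1, formalYMulCube_subst_eq_neg W hzW0]
  set S := (shortModel W c).formalXMulSq.subst z with hS
  set P := W.formalXMulSq.subst zW with hP
  simp only [map_mul, map_add, map_pow]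
  linear_combination (-(zW * (1 + C (c : ℚ) * (C l₁ + C (W.a₁ / 2)) * z))) * hI + (C (c : ℚ) ^ 2 * z ^ 2) * hθ

/-- **`Θ_T · z_W³ = (c·z)³ · Θ^{min}(z_W)`** — the instance of `lineSeries_mul_cube_eq` at the tangent line of `T = (X₀, Y₀)`:
`Θ_T = kummerCubeSeries W c X₀ Y₀ z` (slope `α = tangentSlope`) and `Θ^{min}(t) = Y_W(t) − y_T t³ − λ(X_W(t)t − x_T t³)` with
`x_T = X₀/c² − b₂/12`, `y_T = Y₀/c³ − (a₁x_T + a₃)/2`, `λ = α/c − a₁/2` (valid for all `X₀, Y₀`; for a `3`-torsion point these are the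
integral coordinates and flex slope on `W`, `…MinimalThreeTorsionIntegral`).  This is `Θ_T = ρ³Θ^{min}` with -an's `ρ = c·t_s/z_W`.
[cite: SilvermanAEC2009, III.1 and IV.1] -/
theorem kummerCubeSeries_mul_cube_eq (X₀ Y₀ : ℚ) :
    kummerCubeSeries W c X₀ Y₀ z * W.formalExp.subst ((c : ℚ) • lSeriesLog a) ^ 3 =
      (C (c : ℚ) * z) ^ 3 *
        (W.formalYMulCube.subst (W.formalExp.subst ((c : ℚ) • lSeriesLog a))
          - C (Y₀ / (c : ℚ) ^ 3 - (W.a₁ * (X₀ / (c : ℚ) ^ 2 - W.b₂ / 12) + W.a₃) / 2)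
              * W.formalExp.subst ((c : ℚ) • lSeriesLog a) ^ 3
          - C (tangentSlope W c X₀ Y₀ / c - W.a₁ / 2)
              * (W.formalXMulSq.subst (W.formalExp.subst ((c : ℚ) • lSeriesLog a)) * W.formalExp.subst ((c : ℚ) • lSeriesLog a)
                - C (X₀ / (c : ℚ) ^ 2 - W.b₂ / 12) * W.formalExp.subst ((c : ℚ) • lSeriesLog a) ^ 3)) := by
  have hc' : (c : ℚ) ≠ 0 := by exact_mod_cast hc
  set xT : ℚ := X₀ / (c : ℚ) ^ 2 - W.b₂ / 12 with hxT
  set yT : ℚ := Y₀ / (c : ℚ) ^ 3 - (W.a₁ * xT + W.a₃) / 2 with hyT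
  set lam : ℚ := tangentSlope W c X₀ Y₀ / c - W.a₁ / 2 with hlam
  have hX : (c : ℚ) ^ 2 * (xT + W.b₂ / 12) = X₀ := by rw [hxT]; field_simp; ring
  have hY : (c : ℚ) ^ 3 * (yT + W.a₁ / 2 * xT + W.a₃ / 2) = Y₀ := by rw [hyT]; field_simp; ring
  have hα : (c : ℚ) * (lam + W.a₁ / 2) = tangentSlope W c X₀ Y₀ := by rw [hlam]; field_simp; ring
  have h := lineSeries_mul_cube_eq W hc vc hu hr hs ht a hz xT yT lam
  rw [hX, hY, hα] at h
  rw [kummerCubeSeries, smul_eq_C_mul, smul_eq_C_mul, smul_eq_C_mul]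
  exact h

end Transport

/-! ## §5 Without the auxiliary `vc` -/

/-- **`Θ_T · z_W³ = (c·z)³ · Θ^{min}(z_W)`, hypothesis-free form** (the change of variables `(c⁻¹, −b₂/12, −a₁/2, a₁b₂/24 − a₃/2)`
exists for every `c ≠ 0`). [cite: SilvermanAEC2009, III.1 and IV.1] -/
theorem kummerCubeSeries_mul_cube_eq' (W : WeierstrassCurve ℚ) {c : ℤ} (hc : c ≠ 0) (a : ℕ → ℤ) {z : ℚ⟦X⟧}
    (hz : IsParamGerm W c a z) (X₀ Y₀ : ℚ) :
    kummerCubeSeries W c X₀ Y₀ z * W.formalExp.subst ((c : ℚ) • lSeriesLog a) ^ 3 =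
      (C (c : ℚ) * z) ^ 3 *
        (W.formalYMulCube.subst (W.formalExp.subst ((c : ℚ) • lSeriesLog a))
          - C (Y₀ / (c : ℚ) ^ 3 - (W.a₁ * (X₀ / (c : ℚ) ^ 2 - W.b₂ / 12) + W.a₃) / 2)
              * W.formalExp.subst ((c : ℚ) • lSeriesLog a) ^ 3
          - C (tangentSlope W c X₀ Y₀ / c - W.a₁ / 2)
              * (W.formalXMulSq.subst (W.formalExp.subst ((c : ℚ) • lSeriesLog a)) * W.formalExp.subst ((c : ℚ) • lSeriesLog a)
                - C (X₀ / (c : ℚ) ^ 2 - W.b₂ / 12) * W.formalExp.subst ((c : ℚ) • lSeriesLog a) ^ 3)) := by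
  have hc' : (c : ℚ) ≠ 0 := by exact_mod_cast hc
  set vc : VariableChange ℚ := ⟨Units.mk0 ((c : ℚ)⁻¹) (inv_ne_zero hc'), -(W.b₂ / 12), -(W.a₁ / 2),
    W.a₁ * W.b₂ / 24 - W.a₃ / 2⟩ with hvc
  exact kummerCubeSeries_mul_cube_eq W hc vc (by rw [hvc, Units.val_mk0]) rfl rfl rfl a hz X₀ Y₀

/-- **`z = θ(z_W)` and the cleared `θ`, hypothesis-free form**: `c·z·(X_W − (a₁/2)z_W X_W − (a₃/2)z_W³) = z_W X_W + (b₂/12)z_W³`.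
[cite: SilvermanAEC2009, III.1 and IV.1] -/
theorem shortGerm_mul_eq' (W : WeierstrassCurve ℚ) {c : ℤ} (hc : c ≠ 0) (a : ℕ → ℤ) {z : ℚ⟦X⟧} (hz : IsParamGerm W c a z) :
    C (c : ℚ) * z * (W.formalXMulSq.subst (W.formalExp.subst ((c : ℚ) • lSeriesLog a))
        - C (W.a₁ / 2) * W.formalExp.subst ((c : ℚ) • lSeriesLog a)
            * W.formalXMulSq.subst (W.formalExp.subst ((c : ℚ) • lSeriesLog a))
        - C (W.a₃ / 2) * W.formalExp.subst ((c : ℚ) • lSeriesLog a) ^ 3) =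
      W.formalExp.subst ((c : ℚ) • lSeriesLog a) * W.formalXMulSq.subst (W.formalExp.subst ((c : ℚ) • lSeriesLog a))
        + C (W.b₂ / 12) * W.formalExp.subst ((c : ℚ) • lSeriesLog a) ^ 3 := by
  have hc' : (c : ℚ) ≠ 0 := by exact_mod_cast hc
  set vc : VariableChange ℚ := ⟨Units.mk0 ((c : ℚ)⁻¹) (inv_ne_zero hc'), -(W.b₂ / 12), -(W.a₁ / 2),
    W.a₁ * W.b₂ / 24 - W.a₃ / 2⟩ with hvc
  exact shortGerm_mul_eq W hc vc (by rw [hvc, Units.val_mk0]) rfl rfl rfl a hz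

end Summit.BirchSwinnertonDyer.BirchSwinnertonDyer.Theorems.ManinLocalTwoThree.ShortGermTransport

end
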